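import Mathlib.Data.Complex.Basic
import Literature.Computability.AlgebraicComplexity.DeterminantalComplexityProofs

/-!
# `DetqpThesis` (stmt-ValiantsHypothesis-0315), line `chow-rank-ladder` — the degree floor
# `2n ≤ dc (P n r)` of the rank-`r` permanent

The rank-`r` permanent is `P n r := per_n (U Vᵀ)`, i.e. the generic permanent `perPoly (Fin n) ℂ`
with `x_{ij}` replaced by `Σ_a U_{ia} V_{ja}`, `U_{ia} = X (inl (i, a))`, `V_{ja} = X (inr (j, a))`
(`2nr` variables, degree `2n`).  Every rung of the rank ladder of the line (`stub_polyRung`,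
`stub_kvRung`, the bet `stub_rankHardness`) starts from the `r`-uniform DEGREE FLOOR
`2n ≤ dc (P n r)` (`1 ≤ r`), proved here unconditionally:

* `rankPer_isHomogeneous`: `P n r` is a form of degree `2n` — the entries `Σ_a U_{ia} V_{ja}` are
  quadratic forms and `per_n` is a form of degree `n` (`MvPolynomial.IsHomogeneous.aeval`);
* `aeval_indicator_rankPer`: at the point `U_{ia} = [a = a₀]`, `V_{ja} = 1` the matrix `U Vᵀ` is
  the all-ones matrix, whose permanent is `n!`; so `P n r ≠ 0` for `1 ≤ r` (`rankPer_ne_zero`);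
* hence `totalDegree (P n r) = 2n` (`totalDegree_rankPer`) and, by the degree bound
  `totalDegree f ≤ dc f` (Mignon–Ressayre 2004, §1; `totalDegree_le_determinantalComplexity_holds`),
  `2n ≤ dc (P n r)` (`two_mul_le_dc_rankPer`).

(For `r = 1` the floor is sharp: `P n 1 = n! · Π_i U_{i0} · Π_j V_{j0}` is a product of `2n`
variables up to a unit, of `dc` exactly `2n`.)

Sources: T. Mignon, N. Ressayre, *A quadratic bound for the determinant and permanent problem*,
Int. Math. Res. Not. 2004:79, §1 (`deg f ≤ dc f`); P. Bürgisser, *Completeness and Reduction in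
Algebraic Complexity Theory*, Springer 2000, §2.1, (2.2) (the permanent is a form of degree `n`);
A. Barvinok, *Two algorithmic results for the traveling salesman problem*, Math. Oper. Res. 21
(1996), §3 (the permanent on rank-`r` matrices); folklore.
-/

-- single-conjunct layout: Sub = Summit, duplicated namespace component intended
set_option linter.dupNamespace false

noncomputable section

namespace Summit.ValiantsHypothesis.ValiantsHypothesis.Theorems.DetQPDetqpThesis.ChowRankDegreeFloor

open MvPolynomial
open Literature.Computability.AlgebraicComplexity

/-- The rank-`r` permanent `P n r = per_n (U Vᵀ)` is homogeneous of degree `2n`: `per_n` is a form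
of degree `n` (`perPoly_isHomogeneous`, Bürgisser 2000, §2.1) and each substituted entry
`Σ_a U_{ia} V_{ja}` is a quadratic form (`MvPolynomial.IsHomogeneous.aeval`). [folklore] -/
theorem rankPer_isHomogeneous (n r : ℕ) :
    (aeval (fun x : Fin n × Fin n => ∑ a : Fin r,
      (X (Sum.inl (x.1, a)) * X (Sum.inr (x.2, a)) :
        MvPolynomial ((Fin n × Fin r) ⊕ (Fin n × Fin r)) ℂ))
      (perPoly (Fin n) ℂ)).IsHomogeneous (2 * n) := by
  have h := (perPoly_isHomogeneous (n := Fin n) (k := ℂ)).aeval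
    (fun x : Fin n × Fin n => ∑ a : Fin r,
      (X (Sum.inl (x.1, a)) * X (Sum.inr (x.2, a)) :
        MvPolynomial ((Fin n × Fin r) ⊕ (Fin n × Fin r)) ℂ)) (n := 2)
    fun x => IsHomogeneous.sum _ _ _ fun a _ => (isHomogeneous_X _ _).mul (isHomogeneous_X _ _)
  simpa only [Fintype.card_fin] using h

/-- At the point `U_{ia} = [a = a₀]`, `V_{ja} = 1` the matrix `U Vᵀ` is the all-ones `n × n`
matrix, so the rank-`r` permanent evaluates to `per (1)_{ij} = n!` (Bürgisser 2000, (2.2):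
evaluating the generic permanent; `|𝔖_n| = n!`, `Fintype.card_perm`). [folklore] -/
theorem aeval_indicator_rankPer (n r : ℕ) (a₀ : Fin r) :
    aeval (Sum.elim (fun ib : Fin n × Fin r => if ib.2 = a₀ then (1 : ℂ) else 0)
        (fun _ : Fin n × Fin r => (1 : ℂ)))
      (aeval (fun x : Fin n × Fin n => ∑ a : Fin r,
        (X (Sum.inl (x.1, a)) * X (Sum.inr (x.2, a)) :
          MvPolynomial ((Fin n × Fin r) ⊕ (Fin n × Fin r)) ℂ))
        (perPoly (Fin n) ℂ)) = (n.factorial : ℂ) := by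
  rw [comp_aeval_apply]
  simp only [map_sum, map_mul, aeval_X, Sum.elim_inl, Sum.elim_inr, mul_one,
    Finset.sum_ite_eq', Finset.mem_univ, if_true]
  rw [aeval_eq_eval, eval_perPoly]
  simp [Matrix.permanent, Fintype.card_perm]

/-- For `1 ≤ r` the rank-`r` permanent `P n r` is not the zero polynomial: it takes the value
`n! ≠ 0` (`aeval_indicator_rankPer`; `ℂ` has characteristic zero). [folklore] -/
theorem rankPer_ne_zero (n r : ℕ) (hr : 1 ≤ r) :
    aeval (fun x : Fin n × Fin n => ∑ a : Fin r,
      (X (Sum.inl (x.1, a)) * X (Sum.inr (x.2, a)) :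
        MvPolynomial ((Fin n × Fin r) ⊕ (Fin n × Fin r)) ℂ))
      (perPoly (Fin n) ℂ) ≠ 0 := by
  intro h
  have h1 := aeval_indicator_rankPer n r ⟨0, hr⟩
  rw [h, map_zero] at h1
  exact (Nat.cast_ne_zero.mpr (Nat.factorial_ne_zero n)) h1.symm

/-- For `1 ≤ r` the rank-`r` permanent `P n r` has total degree exactly `2n`: a nonzero
(`rankPer_ne_zero`) form of degree `2n` (`rankPer_isHomogeneous`;
`MvPolynomial.IsHomogeneous.totalDegree`). [folklore] -/
theorem totalDegree_rankPer (n r : ℕ) (hr : 1 ≤ r) :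
    (aeval (fun x : Fin n × Fin n => ∑ a : Fin r,
      (X (Sum.inl (x.1, a)) * X (Sum.inr (x.2, a)) :
        MvPolynomial ((Fin n × Fin r) ⊕ (Fin n × Fin r)) ℂ))
      (perPoly (Fin n) ℂ)).totalDegree = 2 * n :=
  (rankPer_isHomogeneous n r).totalDegree (rankPer_ne_zero n r hr)

/-- **The degree floor of the rank ladder: `2n ≤ dc (P n r)` for `1 ≤ r`.**  The rank-`r`
permanent `P n r = per_n (U Vᵀ)` has total degree `2n` (`totalDegree_rankPer`), and the
determinant of an `m × m` matrix of affine linear forms has total degree `≤ m`, so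
`totalDegree f ≤ dc f` (Mignon–Ressayre 2004, §1; `totalDegree_le_determinantalComplexity_holds`).
This is the `r`-uniform bound every rung (`stub_polyRung`, `stub_kvRung`, `stub_rankHardness`)
of the line `chow-rank-ladder` starts from; for `r = 1` it is sharp. [folklore] -/
theorem two_mul_le_dc_rankPer : ∀ n r : ℕ, 1 ≤ r →
    2 * n ≤ determinantalComplexity (aeval (fun x : Fin n × Fin n => ∑ a : Fin r,
      (X (Sum.inl (x.1, a)) * X (Sum.inr (x.2, a)) : MvPolynomial ((Fin n × Fin r) ⊕ (Fin n × Fin r)) ℂ))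
      (perPoly (Fin n) ℂ)) := by
  intro n r hr
  rw [← totalDegree_rankPer n r hr]
  exact totalDegree_le_determinantalComplexity_holds _

end Summit.ValiantsHypothesis.ValiantsHypothesis.Theorems.DetQPDetqpThesis.ChowRankDegreeFloor

end
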